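import Literature.MathematicalPhysics.QuantumLattice.StrongCouplingBosonisation
import Literature.MathematicalPhysics.QuantumLattice.StrongCouplingChiralLROInfiniteVolume
import Literature.MathematicalPhysics.StatisticalMechanics.ComplexSpinSchwingerDysonSharp
import Literature.MathematicalPhysics.StatisticalMechanics.ComplexSpinCorrelationBoundAllColours
import HarnessLib

/-!
# Chiral long-range order of `β = 0` `U(N)` lattice gauge theory with one massless staggered fermion,
# for EVERY number of colours `N` (Salmhofer–Seiler's Cor. 4.9 without `N ≤ 4`), at the gauge level

Salmhofer–Seiler (CMP 139 (1991)) prove Cor. 4.9 — chiral long-range order at `β = 0`, `m = 0`, in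
`ν ≥ 4` dimensions — for `U(N)` with `N ≤ 4` (and `N = 5`, `ν ≥ 5`), the restriction coming from the
Schwinger–Dyson constant `K(N)` of Lemma 4.7/(4.39).  The Literature file `ComplexSpinSchwingerDysonSharp`
removes it (`uN_chiralLRO_allN`: the `U(N)` bond data `a_n = (N-n)!N^{2n}/(N!n!)` satisfy
`n a_n ≤ N² a_{n-1}`, so (4.38) holds with `K(N)` replaced by `N`, and `S(ν) < ½` suffices).  This file
transports that statement from the complex spin system (2.21) to the honest Berezin–Haar expectations of
the gauge theory through the tree's bosonisation identity `fermiExpect_spinObs` ((2.21)/Remark 3.4(2)),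
exactly as `chiralLRO_gauge` does for `N ≤ 4`:

* `chiralLRO_gauge_allN` — for every `N ≥ 1`, `ν ≥ 4`: `∃ c > 0, L₀` such that for every even `L ≥ L₀`
  and all link signs `Γ` with `Γ² = 1`, `|Λ|⁻¹ ∑_x Re⟨(ψ̄ψ(0)/2N)(ψ̄ψ(x)/2N)⟩_Λ ≥ c` at `β = 0`, `m = 0`;
* `chiralLRO_gauge_staggered_allN` — the same for the staggered signs `Γ_μ(x)` of (2.4);
* `chiralLRO_gauge_allN_explicit` — with the explicit constant `c = 3/(80νN)`.

INFINITE VOLUME (appended; the twins of `StrongCouplingChiralLROInfiniteVolume` without `N ≤ 4`, through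
`ComplexSpinCorrelationBoundAllColours`, which removes Remark 4.6's `w_k ≥ 0` from Thm. 3.18 by reading
(3.61)–(3.62) in the dimer picture, `N a_{n-1} ≤ n a_n`):

* `gauge_twoPoint_mem_Icc_allN` — Thm. 3.18 (1) for the fermionic two-point function, every `N ≥ 1`:
  `0 ≤ Re⟨(ψ̄ψ(0)/2N)(ψ̄ψ(x)/2N)⟩_Λ ≤ 1` (`m ≥ 0`, even torus, any link signs `Γ² = 1`);
* `gauge_exists_subseq_tendsto_twoPoint_allN` — Thm. 3.18 (2): pointwise thermodynamic limits of the
  two-point function exist along a subsequence of any sequence of even tori, every `N ≥ 1`;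
* **`gauge_chiralLRO_infiniteVolume_allN`** (`_staggered_allN` for the phases (2.4)) — Remark 4.10 (1)
  (4.43) with Cor. 4.9 for EVERY `N ≥ 1`, `ν ≥ 4`: every pointwise limit
  `T(x) = lim_n Re⟨(ψ̄ψ(0)/2N)(ψ̄ψ(x̄)/2N)⟩_{Λ_n}` at `m = 0`, `β = 0` vanishes on the even sublattice and
  `lim_{|x|→∞, ε(x)=-1} T(x) = limsup_x T(x) = 2c₀ > 0`.

Scope (honest): `β = 0` only, `U(N)` (not `SU(N)`), one staggered flavour, `m = 0`, finite even tori,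
long-range order in the Cesàro form of (4.42); nothing about `β > 0` (see the Ventures files), the
condensate, the continuum or a mass gap.  Not in print for `N ≥ 5` (`ν = 4`).

## References
* [SalmhoferSeiler1991] M. Salmhofer, E. Seiler, Commun. Math. Phys. 139 (1991) 395–432, (2.21)–(2.24),
  Remark 3.4(2), Thm. 3.18, Thm. 4.8, Cor. 4.9, Remark 4.10 (1) (4.43).
* [RossiWolff1984] P. Rossi, U. Wolff, Nucl. Phys. B 248 (1984) 105.
-/

noncomputable section

namespace Literature.MathematicalPhysics.QuantumLattice

namespace StrongCoupling

open _root_.MeasureTheory MvPolynomial Filter Topology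
open Literature.Probability.LatticeModels (TorusSite Site)
open Literature.Probability.LatticeModels
open Literature.MathematicalPhysics.StatisticalMechanics

variable {ν : ℕ} {N : ℕ}

/-- **Cor. 4.9 at the gauge level, EVERY `N ≥ 1`, `ν ≥ 4`, with an explicit constant**: for the `β = 0`
`U(N)` lattice gauge theory with one massless staggered fermion (any link signs `Γ` with `Γ² = 1`),
`|Λ|⁻¹ ∑_x Re⟨(ψ̄ψ(0)/2N)(ψ̄ψ(x)/2N)⟩_Λ ≥ 3/(80νN)` on all large even tori. [cite: SalmhoferSeiler1991, Cor. 4.9 with (2.21), (2.23) and Prop. 4.2(4)] -/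
theorem chiralLRO_gauge_allN_explicit (hN : 1 ≤ N) (hν : 4 ≤ ν) :
    ∃ L₀ : ℕ, ∀ (L : ℕ) [NeZero L] [LinearOrder (TorusSite ν L)]
      (Γ : TorusSite ν L × Fin ν → ℂ), (∀ b, Γ b ^ 2 = 1) → Even L → L₀ ≤ L →
        3 / (80 * ν * N) ≤ (Fintype.card (TorusSite ν L) : ℝ)⁻¹ *
          ∑ x : TorusSite ν L, (fermiExpect (torusLinks ν L) Γ ((0 : ℝ) : ℂ)
            (fun _ => (((2 * N : ℂ)⁻¹ • meson 0) * ((2 * N : ℂ)⁻¹ • meson x) : FermiAlg (TorusSite ν L) N))).re := by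
  obtain ⟨L₀, hL₀⟩ := ComplexSpin.uN_chiralLRO_allN_explicit (ν := ν) hN hν
  refine ⟨max L₀ 2, fun L _ _ Γ hΓ hE hL => ?_⟩
  have hL1 : 1 < L := by have := le_max_right L₀ 2; omega
  have key := hL₀ L hE ((le_max_left L₀ 2).trans hL)
  refine key.trans_eq ?_
  congr 1
  refine Finset.sum_congr rfl fun x _ => ?_
  rw [← spinObs_X_mul_X, fermiExpect_spinObs hL1 Γ hΓ, Complex.ofReal_re]

/-- **Cor. 4.9 at the gauge level for EVERY `N ≥ 1`, `ν ≥ 4`** (the tree's `chiralLRO_gauge` without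
`N ≤ 4`): `β = 0` `U(N)` lattice gauge theory with one massless staggered fermion has chiral long-range
order, `|Λ|⁻¹ ∑_x Re⟨(ψ̄ψ(0)/2N)(ψ̄ψ(x)/2N)⟩_Λ ≥ c > 0` on all large even tori, for every number of
colours. [cite: SalmhoferSeiler1991, Cor. 4.9 with (2.21) and (2.23)] -/
theorem chiralLRO_gauge_allN (hN : 1 ≤ N) (hν : 4 ≤ ν) :
    ∃ c : ℝ, 0 < c ∧ ∃ L₀ : ℕ, ∀ (L : ℕ) [NeZero L] [LinearOrder (TorusSite ν L)]
      (Γ : TorusSite ν L × Fin ν → ℂ), (∀ b, Γ b ^ 2 = 1) → Even L → L₀ ≤ L →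
        c ≤ (Fintype.card (TorusSite ν L) : ℝ)⁻¹ *
          ∑ x : TorusSite ν L, (fermiExpect (torusLinks ν L) Γ ((0 : ℝ) : ℂ)
            (fun _ => (((2 * N : ℂ)⁻¹ • meson 0) * ((2 * N : ℂ)⁻¹ • meson x) : FermiAlg (TorusSite ν L) N))).re := by
  have hνpos : (0 : ℝ) < ν := by exact_mod_cast (show 0 < ν by omega)
  have hNpos : (0 : ℝ) < N := by exact_mod_cast hN
  obtain ⟨L₀, hL₀⟩ := chiralLRO_gauge_allN_explicit (ν := ν) hN hν
  exact ⟨3 / (80 * ν * N), by positivity, L₀, hL₀⟩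

/-- **The same for the staggered action itself** (signs `Γ_μ(x)` of (2.4)), every `N ≥ 1`, `ν ≥ 4`. [cite: SalmhoferSeiler1991, Cor. 4.9 and (2.21)] -/
theorem chiralLRO_gauge_staggered_allN (hN : 1 ≤ N) (hν : 4 ≤ ν) :
    ∃ c : ℝ, 0 < c ∧ ∃ L₀ : ℕ, ∀ (L : ℕ) [NeZero L] [LinearOrder (TorusSite ν L)], Even L → L₀ ≤ L →
      c ≤ (Fintype.card (TorusSite ν L) : ℝ)⁻¹ *
        ∑ x : TorusSite ν L, (fermiExpect (torusLinks ν L) (fun p => ((staggeredPhase p.1 p.2 : ℤ) : ℂ)) ((0 : ℝ) : ℂ)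
          (fun _ => (((2 * N : ℂ)⁻¹ • meson 0) * ((2 * N : ℂ)⁻¹ • meson x) : FermiAlg (TorusSite ν L) N))).re := by
  obtain ⟨c, hc, L₀, h⟩ := chiralLRO_gauge_allN (ν := ν) hN hν
  exact ⟨c, hc, L₀, fun L _ _ hE hL => h L _ (fun p => staggeredPhase_sq p.1 p.2) hE hL⟩

/-! ### Infinite volume, every `N ≥ 1` -/

/-- Even and nonzero ⇒ `> 1`. [folklore] -/
private theorem one_lt_of_even' {L : ℕ} [NeZero L] (hL : Even L) : 1 < L := by
  have := NeZero.ne L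
  obtain ⟨k, hk⟩ := hL
  omega

/-- **Thm. 3.18 (1) at the gauge level, EVERY `N ≥ 1`**: `0 ≤ Re⟨(ψ̄ψ(0)/2N)(ψ̄ψ(x)/2N)⟩_Λ ≤ 1` in the
`β = 0` `U(N)` theory with one staggered fermion of mass `m ≥ 0` on an even torus (`ν ≥ 1`, any linear
order of the sites, any link signs `Γ² = 1`); no `w_k ≥ 0` (Remark 4.6) needed.
[cite: SalmhoferSeiler1991, Thm. 3.18 (1) (3.59) with (2.21) and (2.23)] -/
theorem gauge_twoPoint_mem_Icc_allN (hN : 1 ≤ N) (hν : 1 ≤ ν) {L : ℕ} [NeZero L]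
    [LinearOrder (TorusSite ν L)] (hL : Even L) (Γ : TorusSite ν L × Fin ν → ℂ)
    (hΓ : ∀ b, Γ b ^ 2 = 1) {m : ℝ} (hm : 0 ≤ m) (x : TorusSite ν L) :
    (fermiExpect (torusLinks ν L) Γ (m : ℂ)
        (fun _ => (((2 * N : ℂ)⁻¹ • meson 0) * ((2 * N : ℂ)⁻¹ • meson x) :
          FermiAlg (TorusSite ν L) N))).re ∈ Set.Icc (0 : ℝ) 1 := by
  have hL1 : 1 < L := one_lt_of_even' hL
  rw [fermiExpect_twoPoint_eq_corrFn hL1 Γ hΓ m, Complex.ofReal_re]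
  exact ComplexSpin.uN_corrFn_mem_Icc_allN hν hL (by omega) hN hm x

/-- **Thm. 3.18 (2) at the gauge level, EVERY `N ≥ 1`**: along a subsequence of any sequence of even
tori (any linear orders, any link signs `Γ_n² = 1`), the two-point functions
`Re⟨(ψ̄ψ(0)/2N)(ψ̄ψ(x̄)/2N)⟩_{Λ_n}` (`m ≥ 0`, `β = 0`) converge for every `x ∈ ℤ^ν`.
[cite: SalmhoferSeiler1991, Thm. 3.18 (2) (3.60) with (2.21)] -/
theorem gauge_exists_subseq_tendsto_twoPoint_allN (hN : 1 ≤ N) (hν : 1 ≤ ν) {m : ℝ} (hm : 0 ≤ m)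
    (Ls : ℕ → ℕ) [∀ n, NeZero (Ls n)] [∀ n, LinearOrder (TorusSite ν (Ls n))]
    (hev : ∀ n, Even (Ls n)) (Γ : ∀ n, TorusSite ν (Ls n) × Fin ν → ℂ) (hΓ : ∀ n b, Γ n b ^ 2 = 1) :
    ∃ φ : ℕ → ℕ, StrictMono φ ∧ ∃ T : Site ν → ℝ, ∀ x,
      Tendsto (fun n => (fermiExpect (torusLinks ν (Ls (φ n))) (Γ (φ n)) (m : ℂ)
        (fun _ => (((2 * N : ℂ)⁻¹ • meson 0) * ((2 * N : ℂ)⁻¹ • meson (Torus.proj (Ls (φ n)) x)) :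
          FermiAlg (TorusSite ν (Ls (φ n))) N))).re) atTop (nhds (T x)) := by
  obtain ⟨φ, hφ, T, hT⟩ := ComplexSpin.uN_exists_subseq_tendsto_corrFn_allN Ls hν hN hm hev
  refine ⟨φ, hφ, T, fun x => (hT x).congr fun n => ?_⟩
  rw [fermiExpect_twoPoint_eq_corrFn (one_lt_of_even' (hev (φ n))) (Γ (φ n)) (hΓ (φ n)) m,
    Complex.ofReal_re]

/-- **Remark 4.10 (1) (4.43) with Corollary 4.9, at the gauge level and in the thermodynamic limit, for
EVERY `N ≥ 1`** (`ν ≥ 4`; the twin of `gauge_chiralLRO_infiniteVolume` without `N ≤ 4`): for even tori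
`Λ_n = (ℤ/L_n)^ν` with `L_n → ∞` (any linear orders of the sites, any link signs `Γ_n² = 1`) and any
pointwise thermodynamic limit `T(x) = lim_n Re⟨(ψ̄ψ(0)/2N)(ψ̄ψ(x̄)/2N)⟩_{Λ_n}` of the `m = 0` two-point
function of `β = 0` `U(N)` lattice gauge theory with massless staggered fermions: there is `c₀ > 0` with
`lim_{|x|→∞, ε(x)=-1} T(x) = limsup_{x∈ℤ^ν} T(x) = 2c₀` and `T = 0` on the even sublattice.  Honest
scope: `β = 0`, one flavour, pointwise limits along even tori; nothing about `β > 0`, the continuum,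
`SU(N)` or the summit's `QCD` conjunct; not in print for `N ≥ 5`.
[cite: SalmhoferSeiler1991, Remark 4.10 (1) (4.43) with Cor. 4.9 and (2.21)] -/
theorem gauge_chiralLRO_infiniteVolume_allN (hN : 1 ≤ N) (hν : 4 ≤ ν)
    (Ls : ℕ → ℕ) [∀ n, NeZero (Ls n)] [∀ n, LinearOrder (TorusSite ν (Ls n))]
    (hev : ∀ n, Even (Ls n)) (hLs : Tendsto Ls atTop atTop)
    (Γ : ∀ n, TorusSite ν (Ls n) × Fin ν → ℂ) (hΓ : ∀ n b, Γ n b ^ 2 = 1) {T : Site ν → ℝ}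
    (hT : ∀ x, Tendsto (fun n => (fermiExpect (torusLinks ν (Ls n)) (Γ n) ((0 : ℝ) : ℂ)
      (fun _ => (((2 * N : ℂ)⁻¹ • meson 0) * ((2 * N : ℂ)⁻¹ • meson (Torus.proj (Ls n) x)) :
        FermiAlg (TorusSite ν (Ls n)) N))).re) atTop (nhds (T x))) :
    ∃ c₀ : ℝ, 0 < c₀ ∧ (∀ x, ComplexSpin.latSgn x = 1 → T x = 0) ∧
      Tendsto T (cofinite ⊓ 𝓟 {x | ComplexSpin.latSgn x = -1}) (nhds (2 * c₀)) ∧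
      Filter.limsup T cofinite = 2 * c₀ := by
  have hT' : ∀ x, Tendsto (fun n => ComplexSpin.corrFn (L := Ls n) N 0 (ComplexSpin.uNBondCoeff N)
      (Torus.proj (Ls n) x)) atTop (nhds (T x)) := by
    intro x
    refine (hT x).congr fun n => ?_
    rw [fermiExpect_twoPoint_eq_corrFn (one_lt_of_even' (hev n)) (Γ n) (hΓ n) 0, Complex.ofReal_re]
  obtain ⟨c₀, hc0, -, heven, hTodd, hlimsup⟩ :=
    ComplexSpin.uN_chiralLRO_thermodynamicLimit_allN Ls hN hν hev hLs hT'
  exact ⟨c₀, hc0, heven, hTodd, hlimsup⟩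

/-- **The same for the staggered action itself** (link signs `Γ_μ(x)` of (2.4)): every thermodynamic
limit of `Re⟨(ψ̄ψ(0)/2N)(ψ̄ψ(x̄)/2N)⟩_Λ` at `m = 0`, `β = 0`, EVERY `N ≥ 1`, `ν ≥ 4`, has
`lim_{|x|→∞, ε(x)=-1} T(x) = limsup_x T(x) = 2c₀ > 0`.
[cite: SalmhoferSeiler1991, Remark 4.10 (1) (4.43) with Cor. 4.9 and (2.3)–(2.4)] -/
theorem gauge_chiralLRO_infiniteVolume_staggered_allN (hN : 1 ≤ N) (hν : 4 ≤ ν)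
    (Ls : ℕ → ℕ) [∀ n, NeZero (Ls n)] [∀ n, LinearOrder (TorusSite ν (Ls n))]
    (hev : ∀ n, Even (Ls n)) (hLs : Tendsto Ls atTop atTop) {T : Site ν → ℝ}
    (hT : ∀ x, Tendsto (fun n => (fermiExpect (torusLinks ν (Ls n))
      (fun p => ((staggeredPhase p.1 p.2 : ℤ) : ℂ)) ((0 : ℝ) : ℂ)
      (fun _ => (((2 * N : ℂ)⁻¹ • meson 0) * ((2 * N : ℂ)⁻¹ • meson (Torus.proj (Ls n) x)) :
        FermiAlg (TorusSite ν (Ls n)) N))).re) atTop (nhds (T x))) :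
    ∃ c₀ : ℝ, 0 < c₀ ∧ (∀ x, ComplexSpin.latSgn x = 1 → T x = 0) ∧
      Tendsto T (cofinite ⊓ 𝓟 {x | ComplexSpin.latSgn x = -1}) (nhds (2 * c₀)) ∧
      Filter.limsup T cofinite = 2 * c₀ :=
  gauge_chiralLRO_infiniteVolume_allN hN hν Ls hev hLs (fun _ p => ((staggeredPhase p.1 p.2 : ℤ) : ℂ))
    (fun _ p => staggeredPhase_sq p.1 p.2) hT

end StrongCoupling

end Literature.MathematicalPhysics.QuantumLattice

end
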